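import Literature.Analysis.OperatorTheory.Enflo2023.Vy
import HarnessLib

/-!
# Enflo 2023, v2 eq. (40): the angle between `y` and `ℓ'(T)y = x₀ − [ ]⁻¹x₀` from the dominance condition (33)

Source under adjudication: Per H. Enflo, *On the invariant subspace problem in Hilbert spaces*, arXiv:2305.15442
(v1 2023, v2 2024), bib key `Enflo2023` — a CLAIMED proof of the invariant subspace problem on separable Hilbert
space.  This file belongs to the kernel-tight typing of the manuscript by the b2b-enflo repair cell (Formaliser 2,
Part B).  It records what FOLLOWS from the manuscript's displayed hypotheses; NOTHING here asserts that the
manuscript's main theorem holds, and no declaration concludes the invariant subspace problem for an arbitrary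
operator.  Value (BLOCK-2b): theorems / refutations of typed inferences about a text — not progress on the problem.

## What is typed here (v2 p.18, tex L593–L600; used on p.20 for (46))

(40) reads: `‖ V_yV_y^*[ ]⁻¹x₀ / ‖V_yV_y^*[ ]⁻¹x₀‖ − y/‖y‖ ‖ ≤ γ'(εθ)`, "from Lemmas 2–5 … (33)", with
`γ' → 0` as `(εθ) → 0`.  By (16)–(17), `V_yV_y^*[ ]⁻¹x₀ = x₀ − [ ]⁻¹x₀ = V_y a` where `a = ℓ' = V_y^*[ ]⁻¹x₀` is the
coefficient vector, `(εθ) = ‖a‖²`, and (33) (tex L536–L540) says `|a₀|² ≥ (1 − γ'(εθ))·(εθ)`, i.e.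
`‖L a‖² = Σ_{j ≥ 1}|a_j|² ≤ γ'‖a‖²`.  In the tree's notation (`Vy.lean`): `V_y a = a₀ y + T V_y(L a)` (`V_decomp`),
`‖V_y a − a₀ y‖ ≤ ‖T‖ ‖y‖ (1 − ‖T‖²)^{-1/2} ‖L a‖` (`norm_V_sub_head_le`).

* `norm_dir_sub_le`, `norm_dir_sub_le_of_pos_head` — the elementary direction estimate: if `z = r y + w` with
  `r > 0` REAL then `‖ ‖z‖ y − ‖y‖ z ‖ ≤ 2 ‖y‖ ‖w‖` (the left side is `‖y‖‖z‖ · ‖ẑ − ŷ‖`).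
* `eq40_of_eq33` — (40) FOLLOWS from (33) for a phase-normalised head coefficient `a₀ = r > 0`, with the HONEST
  modulus: `‖ẑ − ŷ‖ · ‖y‖‖z‖ ≤ 2 ‖T‖ (1 − ‖T‖²)^{-1/2} √γ · ‖a‖ ‖y‖²`, and in the shape consumed by
  `PivotRoom.hasNontrivialClosedInvariantSubspace_of_repivoting`'s angle hypothesis `hang` (constraint vector
  `c = y_P`, pivot endpoint `x₀ − v_P = V_{y_P} a_P`): `≤ g · (‖y‖ ‖z‖)` with `g = 2κ/(1 − κ)`,
  `κ = ‖T‖ √γ / ((1 − ‖T‖²)(1 − γ))^{1/2}` (`eq40_hang_of_eq33`).  With `‖T‖ = 10⁻²⁰` (v2 p.1) this is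
  `g ≈ 2·10⁻²⁰ √γ'`, which tends to `0` with `γ'` — all that p.20 needs.
* `printed_eq40_fails` — the PRINTED modulus "`≤ γ'`" is false once `γ' < ‖T‖²`: for orthonormal `e₀, e₁`,
  `T = q ⟨·, e₀⟩ e₁` (`‖T‖ = q`), `y = e₀`, `a = (√(1−γ), √γ, 0, …)` (so (33) holds with equality, `‖a‖ = 1`),
  `z = V_y a = √(1−γ) e₀ + q√γ e₁` has `‖ẑ − ŷ‖ ≥ q√γ·(…) > γ`.  Harmless slip: the route through (46) only uses
  `g → 0` (REPAIR: read `γ'` in (40) as `2·10⁻²⁰√γ'(1 + o(1))`).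
* `eq40_needs_phase` — without the phase normalisation `a₀ > 0` (the paper's standing reduction "multiply `y` and
  `T` by `e^{ir}`, `e^{is}`", v2 p.6 insert, tex L198–L204; kernel: `Vy.V_phase`, `Vy.endpoint_phase_invariant`),
  (40) is false as a statement about `y`: `a₀ = −r` gives `‖ẑ − ŷ‖ = 2`.

STEPS row B10 ((38)–(40)): (40) ⇐ (33) CLOSED here (modulus corrected); (38)–(39) remain first-order heuristics.
No new axioms; every theorem has closure `[propext, Classical.choice, Quot.sound]`.
-/

open scoped InnerProductSpace ENNReal
open Complex

noncomputable section

namespace Literature.Analysis.OperatorTheory.Enflo2023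

namespace Eq40

open Vy

variable {H : Type*} [NormedAddCommGroup H] [InnerProductSpace ℂ H]

/-! ### (1) The direction estimate -/

/-- For any `u, u'`: `‖ ‖u'‖ u − ‖u‖ u' ‖ ≤ 2 ‖u'‖ ‖u − u'‖` (divide by `‖u‖‖u'‖`: the unit vectors of `u`
and `u'` differ by at most `2‖u − u'‖/‖u‖`). [folklore] -/
theorem norm_dir_sub_le (u u' : H) :
    ‖((‖u'‖ : ℝ) : ℂ) • u - ((‖u‖ : ℝ) : ℂ) • u'‖ ≤ 2 * ‖u'‖ * ‖u - u'‖ := by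
  have hsplit : ((‖u'‖ : ℝ) : ℂ) • u - ((‖u‖ : ℝ) : ℂ) • u'
      = ((‖u'‖ : ℝ) : ℂ) • (u - u') + (((‖u'‖ - ‖u‖ : ℝ)) : ℂ) • u' := by
    rw [smul_sub, Complex.ofReal_sub, sub_smul]; abel
  rw [hsplit]
  calc ‖((‖u'‖ : ℝ) : ℂ) • (u - u') + (((‖u'‖ - ‖u‖ : ℝ)) : ℂ) • u'‖
      ≤ ‖((‖u'‖ : ℝ) : ℂ) • (u - u')‖ + ‖(((‖u'‖ - ‖u‖ : ℝ)) : ℂ) • u'‖ := norm_add_le _ _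
    _ = ‖u'‖ * ‖u - u'‖ + |‖u'‖ - ‖u‖| * ‖u'‖ := by
        rw [norm_smul, norm_smul, Complex.norm_real, Complex.norm_real, Real.norm_of_nonneg (norm_nonneg _),
          Real.norm_eq_abs]
    _ ≤ ‖u'‖ * ‖u - u'‖ + ‖u - u'‖ * ‖u'‖ := by
        gcongr
        rw [abs_sub_comm]; exact abs_norm_sub_norm_le u u'
    _ = 2 * ‖u'‖ * ‖u - u'‖ := by ring

/-- If `z = r y + w` with `r > 0` real (phase-normalised head coefficient) then
`‖ ‖z‖ y − ‖y‖ z ‖ ≤ 2 ‖y‖ ‖w‖`. [folklore] -/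
theorem norm_dir_sub_le_of_pos_head {y z w : H} {r : ℝ} (hr : 0 < r) (hz : z = ((r : ℝ) : ℂ) • y + w) :
    ‖((‖z‖ : ℝ) : ℂ) • y - ((‖y‖ : ℝ) : ℂ) • z‖ ≤ 2 * ‖y‖ * ‖w‖ := by
  have h := norm_dir_sub_le z (((r : ℝ) : ℂ) • y)
  have hw : z - ((r : ℝ) : ℂ) • y = w := by rw [hz]; abel
  have hn : ‖((r : ℝ) : ℂ) • y‖ = r * ‖y‖ := by
    rw [norm_smul, Complex.norm_real, Real.norm_of_nonneg hr.le]
  rw [hw, hn] at h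
  -- `‖(r‖y‖) z − ‖z‖ r y‖ = r ‖ ‖y‖ z − ‖z‖ y ‖`
  have hfac : ((r * ‖y‖ : ℝ) : ℂ) • z - ((‖z‖ : ℝ) : ℂ) • (((r : ℝ) : ℂ) • y)
      = ((r : ℝ) : ℂ) • (((‖y‖ : ℝ) : ℂ) • z - ((‖z‖ : ℝ) : ℂ) • y) := by
    rw [smul_sub, smul_smul, smul_smul, Complex.ofReal_mul, mul_comm (((‖z‖ : ℝ) : ℂ)), smul_smul]
  rw [hfac, norm_smul, Complex.norm_real, Real.norm_of_nonneg hr.le] at h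
  have h2 : ‖((‖y‖ : ℝ) : ℂ) • z - ((‖z‖ : ℝ) : ℂ) • y‖ ≤ 2 * ‖y‖ * ‖w‖ := by
    have h3 : r * ‖((‖y‖ : ℝ) : ℂ) • z - ((‖z‖ : ℝ) : ℂ) • y‖ ≤ r * (2 * ‖y‖ * ‖w‖) := by
      calc _ ≤ 2 * (r * ‖y‖) * ‖w‖ := h
        _ = r * (2 * ‖y‖ * ‖w‖) := by ring
    exact le_of_mul_le_mul_left h3 hr
  rwa [norm_sub_rev] at h2

/-! ### (2) (40) from (33), with the honest modulus -/

/-- (33) ⇒ the tail of the coefficient vector is small: `‖L a‖ ≤ √γ ‖a‖` (`‖L a‖² = ‖a‖² − |a₀|²`,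
`Vy.norm_L_apply_sq`). [cite: Enflo2023, v2 p.17, eq. (33)] -/
theorem norm_L_le_of_eq33 {a : ℓ2} {γ : ℝ} (hγ : 0 ≤ γ) (h33 : (1 - γ) * ‖a‖ ^ 2 ≤ ‖a 0‖ ^ 2) :
    ‖L a‖ ≤ Real.sqrt γ * ‖a‖ := by
  have h1 : ‖L a‖ ^ 2 ≤ (Real.sqrt γ * ‖a‖) ^ 2 := by
    rw [norm_L_apply_sq, mul_pow, Real.sq_sqrt hγ]; nlinarith
  exact (sq_le_sq₀ (norm_nonneg _) (by positivity)).mp h1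

variable [CompleteSpace H]

/-- (33) ⇒ `‖V_y a − a₀ y‖ ≤ ‖T‖ (1 − ‖T‖²)^{-1/2} √γ ‖a‖ ‖y‖` (the vector `w` of `z = a₀ y + w`).
[cite: Enflo2023, v2 p.17 (33), p.8 (23)] -/
theorem norm_V_sub_head_le_of_eq33 (T : H →L[ℂ] H) (hT : ‖T‖ < 1) (y : H) {a : ℓ2} {γ : ℝ}
    (hγ : 0 ≤ γ) (h33 : (1 - γ) * ‖a‖ ^ 2 ≤ ‖a 0‖ ^ 2) :
    ‖V T hT y a - a 0 • y‖ ≤ ‖T‖ * Real.sqrt (1 / (1 - ‖T‖ ^ 2)) * Real.sqrt γ * ‖a‖ * ‖y‖ := by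
  have h := norm_V_sub_head_le T hT y a
  have h2 := norm_L_le_of_eq33 hγ h33
  calc ‖V T hT y a - a 0 • y‖ ≤ ‖T‖ * (‖y‖ * Real.sqrt (1 / (1 - ‖T‖ ^ 2))) * ‖L a‖ := h
    _ ≤ ‖T‖ * (‖y‖ * Real.sqrt (1 / (1 - ‖T‖ ^ 2))) * (Real.sqrt γ * ‖a‖) := by gcongr
    _ = ‖T‖ * Real.sqrt (1 / (1 - ‖T‖ ^ 2)) * Real.sqrt γ * ‖a‖ * ‖y‖ := by ring

/-- **(40) FROM (33)** for a phase-normalised head coefficient `a₀ = r > 0`: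
`‖ ‖z‖ y − ‖y‖ z ‖ ≤ 2 ‖T‖ (1 − ‖T‖²)^{-1/2} √γ · ‖a‖ ‖y‖²` where `z = V_y a = x₀ − [ ]⁻¹x₀`; the left side is
`‖y‖ ‖z‖ · ‖ẑ − ŷ‖`, the quantity of (40). [cite: Enflo2023, v2 p.18, eq. (40)] -/
theorem eq40_of_eq33 (T : H →L[ℂ] H) (hT : ‖T‖ < 1) (y : H) {a : ℓ2} {r γ : ℝ} (hr : 0 < r)
    (ha0 : a 0 = ((r : ℝ) : ℂ)) (hγ : 0 ≤ γ) (h33 : (1 - γ) * ‖a‖ ^ 2 ≤ r ^ 2) :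
    ‖((‖V T hT y a‖ : ℝ) : ℂ) • y - ((‖y‖ : ℝ) : ℂ) • V T hT y a‖
      ≤ 2 * (‖T‖ * Real.sqrt (1 / (1 - ‖T‖ ^ 2)) * Real.sqrt γ) * ‖a‖ * ‖y‖ ^ 2 := by
  have h33' : (1 - γ) * ‖a‖ ^ 2 ≤ ‖a 0‖ ^ 2 := by
    rw [ha0, Complex.norm_real, Real.norm_of_nonneg hr.le]; exact h33
  have hw := norm_V_sub_head_le_of_eq33 T hT y hγ h33'
  have hz : V T hT y a = ((r : ℝ) : ℂ) • y + (V T hT y a - a 0 • y) := by rw [ha0]; abel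
  have h := norm_dir_sub_le_of_pos_head hr hz
  calc _ ≤ 2 * ‖y‖ * ‖V T hT y a - a 0 • y‖ := h
    _ ≤ 2 * ‖y‖ * (‖T‖ * Real.sqrt (1 / (1 - ‖T‖ ^ 2)) * Real.sqrt γ * ‖a‖ * ‖y‖) := by gcongr
    _ = 2 * (‖T‖ * Real.sqrt (1 / (1 - ‖T‖ ^ 2)) * Real.sqrt γ) * ‖a‖ * ‖y‖ ^ 2 := by ring

/-- The modulus constant `κ(q, γ) = q (1 − q²)^{-1/2} √γ (1 − γ)^{-1/2}` (`q = ‖T‖`, `γ = γ'(εθ)` of (33)).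
[cite: Enflo2023, v2 p.18, eq. (40)] -/
def kappa (q γ : ℝ) : ℝ := q * Real.sqrt (1 / (1 - q ^ 2)) * Real.sqrt γ / Real.sqrt (1 - γ)

/-- `κ ≥ 0` for `q ≥ 0`. [cite: Enflo2023, v2 p.18, eq. (40)] -/
lemma kappa_nonneg {q γ : ℝ} (hq : 0 ≤ q) : 0 ≤ kappa q γ := by
  unfold kappa; positivity

/-- **(40) IN THE SHAPE OF `PivotRoom`'s ANGLE HYPOTHESIS `hang`** (constraint vector `c = y_P`, pivot endpoint
`x₀ − v_P = z = V_{y_P} a_P`): under (33) with `a₀ = r > 0` and `κ = κ(‖T‖, γ) < 1`,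
`‖ ‖z‖ y − ‖y‖ z ‖ ≤ (2κ/(1 − κ)) · (‖y‖ ‖z‖)`, i.e. `‖ẑ − ŷ‖ ≤ 2κ/(1 − κ)`.
[cite: Enflo2023, v2 p.18 (40), p.20 (46)] -/
theorem eq40_hang_of_eq33 (T : H →L[ℂ] H) (hT : ‖T‖ < 1) (y : H) {a : ℓ2} {r γ : ℝ} (hr : 0 < r)
    (ha0 : a 0 = ((r : ℝ) : ℂ)) (hγ : 0 ≤ γ) (hγ1 : γ < 1) (h33 : (1 - γ) * ‖a‖ ^ 2 ≤ r ^ 2)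
    (hκ : kappa ‖T‖ γ < 1) :
    ‖((‖V T hT y a‖ : ℝ) : ℂ) • y - ((‖y‖ : ℝ) : ℂ) • V T hT y a‖
      ≤ (2 * kappa ‖T‖ γ / (1 - kappa ‖T‖ γ)) * (‖y‖ * ‖V T hT y a‖) := by
  set κ := kappa ‖T‖ γ with hκdef
  set K := ‖T‖ * Real.sqrt (1 / (1 - ‖T‖ ^ 2)) * Real.sqrt γ with hKdef
  have hK : 0 ≤ K := by positivity
  have hκ0 : 0 ≤ κ := kappa_nonneg (norm_nonneg T)
  have h33' : (1 - γ) * ‖a‖ ^ 2 ≤ ‖a 0‖ ^ 2 := by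
    rw [ha0, Complex.norm_real, Real.norm_of_nonneg hr.le]; exact h33
  -- `‖a‖ ≤ r / √(1 − γ)`
  have hsq : 0 < Real.sqrt (1 - γ) := Real.sqrt_pos.mpr (by linarith)
  have ha : ‖a‖ ≤ r / Real.sqrt (1 - γ) := by
    rw [le_div_iff₀ hsq]
    have h1 : (‖a‖ * Real.sqrt (1 - γ)) ^ 2 ≤ r ^ 2 := by
      rw [mul_pow, Real.sq_sqrt (by linarith)]; linarith
    exact (sq_le_sq₀ (by positivity) hr.le).mp h1
  -- `‖w‖ ≤ K ‖a‖ ‖y‖ ≤ κ r ‖y‖`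
  have hw := norm_V_sub_head_le_of_eq33 T hT y hγ h33'
  have hKκ : K * ‖a‖ ≤ κ * r := by
    calc K * ‖a‖ ≤ K * (r / Real.sqrt (1 - γ)) := by gcongr
      _ = κ * r := by rw [hκdef, kappa, hKdef]; ring
  have hw' : ‖V T hT y a - a 0 • y‖ ≤ κ * r * ‖y‖ := by
    calc ‖V T hT y a - a 0 • y‖ ≤ K * ‖a‖ * ‖y‖ := by rw [hKdef]; exact hw
      _ ≤ κ * r * ‖y‖ := by gcongr
  -- `‖z‖ ≥ r‖y‖ − ‖w‖ ≥ (1 − κ) r ‖y‖`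
  have hz : V T hT y a = ((r : ℝ) : ℂ) • y + (V T hT y a - a 0 • y) := by rw [ha0]; abel
  have hry : ‖((r : ℝ) : ℂ) • y‖ = r * ‖y‖ := by
    rw [norm_smul, Complex.norm_real, Real.norm_of_nonneg hr.le]
  have hzlow : (1 - κ) * r * ‖y‖ ≤ ‖V T hT y a‖ := by
    have h1 : ‖((r : ℝ) : ℂ) • y‖ - ‖V T hT y a - a 0 • y‖ ≤ ‖V T hT y a‖ := by
      have := norm_sub_norm_le (((r : ℝ) : ℂ) • y) (((r : ℝ) : ℂ) • y - V T hT y a)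
      rw [sub_sub_cancel, ← norm_neg (((r : ℝ) : ℂ) • y - V T hT y a), neg_sub] at this
      have e : V T hT y a - ((r : ℝ) : ℂ) • y = V T hT y a - a 0 • y := by rw [ha0]
      rw [e] at this; linarith
    rw [hry] at h1; nlinarith
  -- conclude
  have hmain := norm_dir_sub_le_of_pos_head hr hz
  have hden : 0 < 1 - κ := by linarith
  calc ‖((‖V T hT y a‖ : ℝ) : ℂ) • y - ((‖y‖ : ℝ) : ℂ) • V T hT y a‖
      ≤ 2 * ‖y‖ * ‖V T hT y a - a 0 • y‖ := hmain
    _ ≤ 2 * ‖y‖ * (κ * r * ‖y‖) := by gcongr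
    _ = (2 * κ / (1 - κ)) * (‖y‖ * ((1 - κ) * r * ‖y‖)) := by field_simp
    _ ≤ (2 * κ / (1 - κ)) * (‖y‖ * ‖V T hT y a‖) := by
        have hc : 0 ≤ 2 * κ / (1 - κ) := by positivity
        gcongr

/-- Numerics of the honest modulus: for `q ≤ 1/4`, `γ ≤ 1/2`: `κ(q, γ) ≤ 2 q √γ` and `2κ/(1 − κ) ≤ 8 q √γ`.  With
the paper's `q = ‖T‖ = 10⁻²⁰` the (40)-angle is `≤ 8·10⁻²⁰ √γ'` — below the printed `γ'` as soon as `γ' ≥ 10⁻³⁸`, above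
it for `γ' < ‖T‖²` (`printed_eq40_fails`), and `→ 0` either way. [cite: Enflo2023, v2 p.18, eq. (40)] -/
theorem modulus40_le {q γ : ℝ} (hq0 : 0 ≤ q) (hq : q ≤ 1 / 4) (hγ : γ ≤ 1 / 2) :
    kappa q γ ≤ 2 * q * Real.sqrt γ ∧ 2 * kappa q γ / (1 - kappa q γ) ≤ 8 * q * Real.sqrt γ := by
  have hs1 : Real.sqrt (1 / (1 - q ^ 2)) ≤ 6 / 5 := by
    rw [Real.sqrt_le_left (by norm_num)]
    rw [div_le_iff₀ (by nlinarith)]; nlinarith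
  have hs2 : 7 / 10 ≤ Real.sqrt (1 - γ) := by
    rw [Real.le_sqrt (by norm_num) (by linarith)]; nlinarith
  have hsγ : 0 ≤ Real.sqrt γ := Real.sqrt_nonneg γ
  have hsγ1 : Real.sqrt γ ≤ 1 := by
    rw [Real.sqrt_le_left (by norm_num)]; linarith
  have hκ : kappa q γ ≤ 2 * q * Real.sqrt γ := by
    unfold kappa
    rw [div_le_iff₀ (by linarith)]
    have h1 : q * Real.sqrt (1 / (1 - q ^ 2)) * Real.sqrt γ ≤ q * (6 / 5) * Real.sqrt γ := by gcongr
    have h2 : 2 * q * Real.sqrt γ * (7 / 10) ≤ 2 * q * Real.sqrt γ * Real.sqrt (1 - γ) := by gcongr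
    nlinarith
  have hκ0 : 0 ≤ kappa q γ := kappa_nonneg hq0
  have hκhalf : kappa q γ ≤ 1 / 2 := by nlinarith
  refine ⟨hκ, ?_⟩
  rw [div_le_iff₀ (by linarith)]
  nlinarith [mul_nonneg hq0 hsγ]

/-! ### (3) The printed modulus fails below `‖T‖²`; the phase normalisation is needed -/

/-- The rank-one model operator `T x = q ⟨x, e₀⟩ e₁` (`T e₀ = q e₁`, `T e₁ = 0` for `e₀ ⊥ e₁`).
[cite: Enflo2023, v2 p.18, eq. (40)] -/
def modelT (e₀ e₁ : H) (q : ℝ) : H →L[ℂ] H := ((q : ℝ) : ℂ) • (innerSL ℂ e₀).smulRight e₁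

omit [CompleteSpace H] in
/-- Unfolding the model operator. [cite: Enflo2023, v2 p.18, eq. (40)] -/
lemma modelT_apply (e₀ e₁ : H) (q : ℝ) (x : H) : modelT e₀ e₁ q x = ((q : ℝ) : ℂ) • (⟪e₀, x⟫_ℂ • e₁) := by
  simp [modelT, ContinuousLinearMap.smulRight_apply]

omit [CompleteSpace H] in
/-- `‖T‖ ≤ q` for unit `e₀, e₁`. [cite: Enflo2023, v2 p.18, eq. (40)] -/
lemma norm_modelT_le {e₀ e₁ : H} (h0 : ‖e₀‖ = 1) (h1 : ‖e₁‖ = 1) {q : ℝ} (hq : 0 ≤ q) :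
    ‖modelT e₀ e₁ q‖ ≤ q := by
  refine ContinuousLinearMap.opNorm_le_bound _ hq (fun x => ?_)
  rw [modelT_apply, norm_smul, norm_smul, Complex.norm_real, Real.norm_of_nonneg hq, h1, mul_one]
  gcongr
  calc ‖⟪e₀, x⟫_ℂ‖ ≤ ‖e₀‖ * ‖x‖ := norm_inner_le_norm _ _
    _ = ‖x‖ := by rw [h0, one_mul]

/-- The model coefficient vector `a = (√(1−γ), √γ, 0, 0, …) ∈ ℓ²`. [cite: Enflo2023, v2 p.17, eq. (33)] -/
def modelA (γ : ℝ) : ℓ2 :=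
  ((Real.sqrt (1 - γ) : ℝ) : ℂ) • lp.single 2 0 (1 : ℂ) + ((Real.sqrt γ : ℝ) : ℂ) • lp.single 2 1 (1 : ℂ)

/-- `a₀ = √(1 − γ)` (real, positive for `γ < 1`: the phase normalisation holds). [cite: Enflo2023, v2 p.17, eq. (33)] -/
lemma modelA_zero (γ : ℝ) : modelA γ 0 = ((Real.sqrt (1 - γ) : ℝ) : ℂ) := by
  rw [modelA, lp.coeFn_add, Pi.add_apply, lp.coeFn_smul, lp.coeFn_smul, Pi.smul_apply, Pi.smul_apply,
    lp.single_apply, lp.single_apply, Pi.single_eq_same, Pi.single_eq_of_ne (by norm_num : (0 : ℕ) ≠ 1),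
    smul_eq_mul, smul_eq_mul, mul_one, mul_zero, add_zero]

/-- `‖a‖² = 1`, so (33) `|a₀|² ≥ (1 − γ)‖a‖²` holds with EQUALITY. [cite: Enflo2023, v2 p.17, eq. (33)] -/
lemma norm_sq_modelA {γ : ℝ} (hγ : 0 ≤ γ) (hγ1 : γ ≤ 1) : ‖modelA γ‖ ^ 2 = 1 := by
  have horth : ⟪((Real.sqrt (1 - γ) : ℝ) : ℂ) • (lp.single 2 0 (1 : ℂ) : ℓ2),
      ((Real.sqrt γ : ℝ) : ℂ) • (lp.single 2 1 (1 : ℂ) : ℓ2)⟫_ℂ = 0 := by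
    rw [inner_smul_left, inner_smul_right, lp.inner_single_left, lp.single_apply,
      Pi.single_eq_of_ne (by norm_num : (0 : ℕ) ≠ 1), inner_zero_right, mul_zero, mul_zero]
  have h := norm_add_sq_eq_norm_sq_add_norm_sq_of_inner_eq_zero _ _ horth
  have e0 : ‖((Real.sqrt (1 - γ) : ℝ) : ℂ) • (lp.single 2 0 (1 : ℂ) : ℓ2)‖ = Real.sqrt (1 - γ) := by
    rw [norm_smul, Complex.norm_real, Real.norm_of_nonneg (Real.sqrt_nonneg _),
      lp.norm_single (by norm_num), norm_one, mul_one]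
  have e1 : ‖((Real.sqrt γ : ℝ) : ℂ) • (lp.single 2 1 (1 : ℂ) : ℓ2)‖ = Real.sqrt γ := by
    rw [norm_smul, Complex.norm_real, Real.norm_of_nonneg (Real.sqrt_nonneg _),
      lp.norm_single (by norm_num), norm_one, mul_one]
  rw [modelA, sq, h, e0, e1, ← sq, ← sq, Real.sq_sqrt (by linarith), Real.sq_sqrt hγ]; ring

/-- (33) for the model, in the form used by `eq40_of_eq33`: `(1 − γ)‖a‖² ≤ (√(1−γ))² = |a₀|²`.
[cite: Enflo2023, v2 p.17, eq. (33)] -/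
lemma modelA_eq33 {γ : ℝ} (hγ : 0 ≤ γ) (hγ1 : γ ≤ 1) :
    (1 - γ) * ‖modelA γ‖ ^ 2 ≤ Real.sqrt (1 - γ) ^ 2 := by
  rw [norm_sq_modelA hγ hγ1, Real.sq_sqrt (by linarith), mul_one]

/-- `V_y a = √(1−γ) y + √γ T y` for the model coefficient vector. [cite: Enflo2023, v2 p.2 (2), p.17 (33)] -/
lemma V_modelA (T : H →L[ℂ] H) (hT : ‖T‖ < 1) (y : H) (γ : ℝ) :
    V T hT y (modelA γ) = ((Real.sqrt (1 - γ) : ℝ) : ℂ) • y + ((Real.sqrt γ : ℝ) : ℂ) • T y := by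
  rw [modelA, map_add, map_smul, map_smul, V_single, V_single, pow_zero, pow_one, one_apply_eq_self]

/-- **THE PRINTED MODULUS OF (40) FAILS BELOW `‖T‖²`.**  Orthonormal `e₀, e₁`; `T = q⟨·, e₀⟩e₁` with
`‖T‖ ≤ q < 1`; `y = e₀`; `a = (√(1−γ), √γ, 0, …)` with `‖a‖ = 1`, `a₀ = √(1−γ) > 0` ((33) with equality and the
phase normalisation); then `z = V_y a = √(1−γ) e₀ + q√γ e₁` and the (40)-quantity satisfies
`γ · (‖y‖‖z‖) < ‖ ‖z‖ y − ‖y‖ z ‖` whenever `0 < γ < q²` — i.e. `‖ẑ − ŷ‖ > γ`: "(40) ≤ γ'" is false for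
`γ' < ‖T‖² = 10⁻⁴⁰`.  (Only `‖T‖ < 1` is used; the paper's other standing hypotheses on `T` play no role in (40).)
[cite: Enflo2023, v2 p.18, eq. (40)] -/
theorem printed_eq40_fails {e₀ e₁ : H} (h0 : ‖e₀‖ = 1) (h1 : ‖e₁‖ = 1) (h01 : ⟪e₀, e₁⟫_ℂ = 0)
    {q γ : ℝ} (hq : 0 < q) (hq1 : q < 1) (hγ : 0 < γ) (hγq : γ < q ^ 2)
    (hT : ‖modelT e₀ e₁ q‖ < 1 := (norm_modelT_le h0 h1 hq.le).trans_lt hq1) :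
    γ * (‖e₀‖ * ‖V (modelT e₀ e₁ q) hT e₀ (modelA γ)‖)
      < ‖((‖V (modelT e₀ e₁ q) hT e₀ (modelA γ)‖ : ℝ) : ℂ) • e₀
          - ((‖e₀‖ : ℝ) : ℂ) • V (modelT e₀ e₁ q) hT e₀ (modelA γ)‖ := by
  have hγ1 : γ < 1 := hγq.trans_le (by nlinarith)
  -- the vector `z`
  have h00 : ⟪e₀, e₀⟫_ℂ = 1 := by
    rw [inner_self_eq_norm_sq_to_K, h0]; norm_num
  have h11 : ⟪e₁, e₁⟫_ℂ = 1 := by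
    rw [inner_self_eq_norm_sq_to_K, h1]; norm_num
  have h10 : ⟪e₁, e₀⟫_ℂ = 0 := by rw [← inner_conj_symm, h01, map_zero]
  have hTe : modelT e₀ e₁ q e₀ = ((q : ℝ) : ℂ) • e₁ := by rw [modelT_apply, h00, one_smul]
  set z := V (modelT e₀ e₁ q) hT e₀ (modelA γ) with hzdef
  have hz : z = ((Real.sqrt (1 - γ) : ℝ) : ℂ) • e₀ + ((Real.sqrt γ * q : ℝ) : ℂ) • e₁ := by
    rw [hzdef, V_modelA, hTe, smul_smul, ← Complex.ofReal_mul]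
  -- `‖z‖ ≤ 1`
  have hδ : 0 < Real.sqrt γ * q := mul_pos (Real.sqrt_pos.mpr hγ) hq
  have hzn : ‖z‖ ^ 2 = (1 - γ) + (Real.sqrt γ * q) ^ 2 := by
    have horth : ⟪((Real.sqrt (1 - γ) : ℝ) : ℂ) • e₀, ((Real.sqrt γ * q : ℝ) : ℂ) • e₁⟫_ℂ = 0 := by
      rw [inner_smul_left, inner_smul_right, h01, mul_zero, mul_zero]
    have h := norm_add_sq_eq_norm_sq_add_norm_sq_of_inner_eq_zero _ _ horth
    rw [hz, sq, h, norm_smul, norm_smul, Complex.norm_real, Complex.norm_real, h0, h1,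
      Real.norm_of_nonneg (Real.sqrt_nonneg _), Real.norm_of_nonneg hδ.le, mul_one, mul_one, ← sq, ← sq,
      Real.sq_sqrt (by linarith)]
  have hz1 : ‖z‖ ≤ 1 := by
    have hq2 : q ^ 2 ≤ 1 := by nlinarith
    have : ‖z‖ ^ 2 ≤ 1 ^ 2 := by
      rw [hzn, one_pow, mul_pow, Real.sq_sqrt hγ.le]; nlinarith [mul_le_mul_of_nonneg_left hq2 hγ.le]
    exact (sq_le_sq₀ (norm_nonneg _) zero_le_one).mp this
  -- the left side is at most `γ`
  have hL : γ * (‖e₀‖ * ‖z‖) ≤ γ := by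
    rw [h0, one_mul]; exact mul_le_of_le_one_right hγ.le hz1
  -- the right side is at least `q√γ` (its `e₁`-component)
  have hR : Real.sqrt γ * q ≤ ‖((‖z‖ : ℝ) : ℂ) • e₀ - ((‖e₀‖ : ℝ) : ℂ) • z‖ := by
    have hin : ⟪e₁, ((‖z‖ : ℝ) : ℂ) • e₀ - ((‖e₀‖ : ℝ) : ℂ) • z⟫_ℂ = -((Real.sqrt γ * q : ℝ) : ℂ) := by
      rw [h0, inner_sub_right, inner_smul_right, h10, mul_zero, zero_sub, Complex.ofReal_one, one_smul, hz,
        inner_add_right, inner_smul_right, inner_smul_right, h10, h11, mul_zero, zero_add, mul_one]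
    have hcs := norm_inner_le_norm (𝕜 := ℂ) e₁ (((‖z‖ : ℝ) : ℂ) • e₀ - ((‖e₀‖ : ℝ) : ℂ) • z)
    rw [hin, norm_neg, Complex.norm_real, Real.norm_of_nonneg hδ.le, h1, one_mul] at hcs
    exact hcs
  -- `γ < q √γ`
  have hmid : γ < Real.sqrt γ * q := by
    have hs : Real.sqrt γ < q := by
      rw [Real.sqrt_lt' hq]; exact hγq
    calc γ = Real.sqrt γ * Real.sqrt γ := (Real.mul_self_sqrt hγ.le).symm
      _ < Real.sqrt γ * q := mul_lt_mul_of_pos_left hs (Real.sqrt_pos.mpr hγ)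
  linarith

omit [CompleteSpace H] in
/-- **(40) NEEDS THE PHASE NORMALISATION `a₀ > 0`.**  As a statement about `y` and `z = V_y a` alone, (40) is
false without it: `a = (−1, 0, 0, …)` gives `z = −y` and `‖ ‖z‖ y − ‖y‖ z ‖ = 2 ‖y‖‖z‖` (`‖ẑ − ŷ‖ = 2`).  The
manuscript's standing reduction "multiply `y` and `T` by `e^{ir}`, `e^{is}`" (v2 p.6 insert, tex L198–L204;
kernel `Vy.V_phase`, `Vy.coeff_phase`, `Vy.endpoint_phase_invariant`: `z`, `[ ]⁻¹x₀`, `(εθ)` unchanged) supplies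
`a₀ ≥ 0` at each pivot. [cite: Enflo2023, v2 p.6 (tex L198–L204), p.18 (40)] -/
theorem eq40_needs_phase (y : H) :
    ‖((‖((-1 : ℝ) : ℂ) • y‖ : ℝ) : ℂ) • y - ((‖y‖ : ℝ) : ℂ) • (((-1 : ℝ) : ℂ) • y)‖
      = 2 * (‖y‖ * ‖((-1 : ℝ) : ℂ) • y‖) := by
  have hn : ‖((-1 : ℝ) : ℂ) • y‖ = ‖y‖ := by
    rw [norm_smul, Complex.norm_real, Real.norm_eq_abs, abs_neg, abs_one, one_mul]
  rw [hn, smul_smul, ← Complex.ofReal_mul, ← sub_smul, ← Complex.ofReal_sub, norm_smul, Complex.norm_real,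
    Real.norm_eq_abs]
  rw [show ‖y‖ - ‖y‖ * -1 = 2 * ‖y‖ by ring, abs_of_nonneg (by positivity)]
  ring

end Eq40

end Literature.Analysis.OperatorTheory.Enflo2023
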